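import Literature.IUT.HodgeArakelov.PlusMinusTowerCoverModelCompletionV
import Literature.IUT.HodgeArakelov.StableCurveAgreementOfSpecialFibreXu
import Literature.IUT.HodgeArakelov.TemperedCurveXuu
import HarnessLib

/-!
# B15b, level `Π_v`: the identification `Π̂_v ⥲ Π̂_{X̲̲_v}` between the genuine `±`-tower `ofPiCHat` and the genuine [IUTchI] §2 datum
# of the curve `X̲̲_v`

S. Mochizuki, *Inter-universal Teichmüller Theory II*, kurims manuscript (Dec. 2020), §2: Prop 2.1 p. 64 (a) («`Π^tp_{X̲̲_v}` [is] the tempered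
fundamental group determined by the hyperbolic [orbi]curve `X̲̲_v` of [IUTchI], Definition 3.1, (e)»), Prop 2.2 p. 66 («the group “`Π^tp_{X,ℍ}`”
of [IUTchI], Corollary 2.3, (iii), where we take “`X`” to be `X̲̲_v`»), Def 2.3 (i) p. 67 («`Δ_v := Δ^tp_{X̲̲_v}` … denote the respective
profinite completions by means of a “∧”»); *Inter-universal Teichmüller Theory I* (May 2020), §2 pp. 46–47 (the 𝔛-data `Π^tp_X ↪ Π̂_X ↠ G_k`),
Def 3.1 (e) p. 62 [cite: Mochizuki2012, II Prop 2.1 p.64, Prop 2.2 p.66, Def 2.3 (i) p.67; I §2 pp.46–47, Def 3.1 (e) p.62]; [SemiAnbd] §6 p. 69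
(«the profinite completion», unique up to a unique isomorphism) [cite: MochizukiSemiAnbd2006, §6 p.69].  abc-iut cell, MERGE-MAP row **B15b**
(abc-iut-L6-lead §F v1.19al «B15-XUU-TOWER»; holder abc-iut-L6-t19 gen 6) — the `Π_v`-LEVEL TWIN of abc-iut-w5-d132's B15 piece 3
(`StableCurveAgreementOfCompletions` p430970, `StableCurveAgreementOfSpecialFibre(Xu)` p433029 / p434636).  PROOF-ONLY (no `def`, no
`structure`, no `instance`); consumes BY NAME abc-iut-L6-t19's B14 tower `PlusMinusTower.ofPiCHat` (p430122) and its `Π_v`-level completion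
`exists_embHatV_ofPiCHat` (p437138), abc-iut-L6-t7's tempered curve `X̲̲_v` (`DoubleUnderline.temperedCurveXuuOfLevelData`, `groupLevelDataXuu`,
p434855), abc-iut-L5's `StableCurveTemperedData.ofSpecialFibre`, and abc-iut-w5-d132's `ofCoverModel_aug_ι_inclX` (p430433).

* **`PlusMinusTower.exists_isoV_of_isProfiniteCompletion`** — GENERIC CORE at level `Π_v` (twin of `StableCurveAgreement.exists_of_isProfiniteCompletion`):
  for a tower `W` and an [IUTchI] §2 datum `D` with `Π̂_v` a profinite completion of `Π_v = P` through `emb ∘ incl` (`embHatV`), `Π̂_X` a profinite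
  completion of `Π^tp_X` through `ιX`, `φ : P ≃ₜ* Π^tp_X`, continuous augmentations compatible through an injective `σ : G_v → G_k`: there is an
  isomorphism of TOPOLOGICAL groups `eV : Π̂_v ⥲ Π̂_X` with `eV ∘ emb ∘ incl = ιX ∘ φ`, carrying `Π_v` onto `ιX(Π^tp_X)` and `Δ̂_v = Π̂_v ∩ Ker(aug)`
  onto `Δ̂_X` — the uniqueness isomorphism of the profinite completion (abc-iut-L3 `IsProfiniteCompletion.nonempty_continuousMulEquiv`), the kernel
  clause by uniqueness of continuous extensions (`extension_unique`);
* **`PlusMinusTower.exists_isoV_ofPiCHat_ofSpecialFibreXuu`** — the INSTANCE: `W :=` the tower of record `ofPiCHat` (its `Π̂_v = cl toPiCHat(inclX Π^tp_{X̲̲_v})`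
  inside abc-iut-L2-d3's `Π_C`), `D :=` abc-iut-L5's `ofSpecialFibre` OF THE CURVE `X̲̲_v` (`Π^tp := Π^tp_{X̲̲_v} = C.Huu`, `Π̂ :=` its closure in `Π_X`,
  with the induced `GroupLevelData`, for ANY special-fibre data `Sf, h36, Σ ⊆ Σ̂, Π_ℍ, cuspMeetsH` of `X̲̲_v`), `φ := refIso : P ≃ Π_v` (p430122),
  `σ := id_{G_K}`: `eV : Π̂_v ⥲ Π̂_{X̲̲_v}` with `eV (emb (incl x)) = toHat (refIso x)`, `eV(Π_v) = toHat(Π^tp_{X̲̲_v})`, `Δ̂_v ↦ Δ̂_{X̲̲_v}`.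

WHY NO CUSPIDAL DATUM HERE.  abc-iut-L6-t7's `StableCurveAgreement W Cu D` is typed at the level `Π^±_v` (`eHat : Π̂^±_v ⥲ Π̂_{X̲_v}`), where the
cuspidal datum `Cu` of record is produced (p433029 / p434636: the `Π^±_v`-cuspidal inertia groups are the `Π^tp_{X̲_v}`-conjugates of the `I_x`, the
other levels by intersection — print's recipe, Def 2.3 (ii)).  The `Π_v`-level DICTIONARY «the cuspidal inertia groups of `Π_v` so obtained are the
`Π^tp_{X̲̲_v}`-conjugates of the `I_y`, `y` a cusp of `X̲̲_v`, read through `eV`» is Def 2.3 (ii) / Rmk 2.3.1 CONTENT at the genuine model (the cusps of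
`X̲̲_v` over those of `X̲_v`), not a transport — a separate piece; this file delivers the group-level identification every consumer at `Π_v` needs
(e.g. the identification binders `(C, j, e₀, hker)` of the Prop 2.2 (i)′ closers, row «PROP22i-IDENT-GENUINE»).

HONEST LABEL: GENUINE ON BOTH SIDES modulo the binders in the signature — L02 `hZ` and `hN` (the tower's printed inputs), the `GroupLevelData` `d`
of `X_v`, and the special-fibre DATA of `X̲̲_v` (nobody constructs the dual semi-graph of the special fibre of the [EtTh] model; it stays quantified).
Nothing of the series is asserted; consistency ≠ endorsement; no side taken on [IUTchIII] Cor 3.12; constructed ≠ the paper's reconstruction algorithms.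
-/

noncomputable section

namespace Literature.IUT.HodgeArakelov

open Literature.AnabelianGeometry.EtaleTheta Literature.AnabelianGeometry.SemiGraphs Literature.IUT.HodgeTheaters
open scoped Pointwise

universe u

namespace PlusMinusTower

/-! ## Generic core at level `Π_v` -/

section Generic

variable {S : BadPlaceSetting.{u}} {P : TopGroup.{u}} {T : TemperedCoverings S P}

/-- **[IUTchII] Def 2.3 (i) — `Π̂_v ⥲ Π̂_X` FROM A COMMON PROFINITE COMPLETION (B15b generic core, level `Π_v`).**  Let `W` be a `±`-tower and `D`
an [IUTchI] §2 stable-curve datum such that: `Π̂_v` is a profinite completion of `Π_v = P` through `emb ∘ incl` (`embHatV`, `hW`), `Π̂_X` is a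
profinite completion of `Π^tp_X` through `ιX` (`ιXHat`, `hD`), the tempered groups are identified by `φ : P ≃ₜ* Π^tp_X`, the augmentations are
continuous (`haug`, `hpr`) and compatible through an injective `σ : G_v → G_k` (`hσ`, `hcompat`), `G_k` Hausdorff.  Then there is an isomorphism of
topological groups `eV : Π̂_v ⥲ Π̂_X` — the uniqueness isomorphism of the profinite completion, `eV ∘ emb ∘ incl = ιX ∘ φ` — carrying `Π_v` onto
`ιX(Π^tp_X)` and `Δ̂_v = Π̂_v ∩ Ker(aug)` onto `Δ̂_X`.  PROVED.  (`Π_v`-level twin of abc-iut-w5-d132's `StableCurveAgreement.exists_of_isProfiniteCompletion`.)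
([IUTchII] Def 2.3 (i), kurims p.67) [cite: Mochizuki2012, II Def 2.3 (i) p.67] [cite: MochizukiSemiAnbd2006, §6 p.69] -/
theorem exists_isoV_of_isProfiniteCompletion (W : PlusMinusTower T) (D : StableCurveTemperedData.{u})
    (embHatV : P →ₜ* W.hat) (hembHatV : ∀ x, ((embHatV x : W.hat) : W.Corhat) = W.emb (T.incl x))
    (hW : IsProfiniteCompletion embHatV)
    (ιXHat : D.PiTp →ₜ* D.PiHat) (hιXHat : ∀ y, ιXHat y = D.ιX y) (hD : IsProfiniteCompletion ιXHat)
    (φ : P ≃ₜ* D.PiTp)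
    (haug : Continuous (W.aug.comp W.hat.subtype)) [T2Space D.Gk] (hpr : Continuous D.prHat)
    (σ : S.Gk →* D.Gk) (hσc : Continuous σ) (hσ : Function.Injective σ)
    (hcompat : ∀ x : P, D.prTp (φ x) = σ (W.aug (W.emb (T.incl x)))) :
    ∃ eV : W.hat ≃ₜ* D.PiHat,
      (∀ x : P, eV (embHatV x) = D.ιX (φ x)) ∧
      (W.piV.subgroupOf W.hat).map eV.toMulEquiv.toMonoidHom = D.ιX.range ∧
      (∀ g : W.hat, (g : W.Corhat) ∈ W.aug.ker ↔ eV g ∈ D.DeltaHat) := by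
  haveI := hW.compactSpace; haveI := hW.t2Space
  haveI := hD.t2Space
  -- `ιX ∘ φ : P → Π̂_X` is a profinite completion (transport along the source isomorphism `φ`)
  let ιφ : P →ₜ* D.PiHat := ιXHat.comp ⟨φ.toMulEquiv.toMonoidHom, φ.continuous⟩
  have hιφ : IsProfiniteCompletion ιφ :=
    IsProfiniteCompletion.comp_continuousMulEquiv_source hD φ ιφ fun _ => rfl
  -- the uniqueness isomorphism of the profinite completion
  obtain ⟨eV, he⟩ := IsProfiniteCompletion.nonempty_continuousMulEquiv hW hιφ
  have he' : ∀ x : P, eV (embHatV x) = D.ιX (φ x) := fun x => by rw [he x]; exact hιXHat _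
  -- `prHat ∘ eV = σ ∘ aug` on `Π̂_v`: two continuous homomorphisms agreeing on the dense `Π_v`
  let lhs : W.hat →ₜ* D.Gk := ⟨D.prHat.comp eV.toMulEquiv.toMonoidHom, hpr.comp eV.continuous⟩
  let rhs : W.hat →ₜ* D.Gk := ⟨σ.comp (W.aug.comp W.hat.subtype), hσc.comp haug⟩
  have hagree : lhs = rhs := hW.extension_unique lhs rhs fun x => by
    change D.prHat (eV (embHatV x)) = σ (W.aug ((embHatV x : W.hat) : W.Corhat))
    rw [he', hembHatV, ← hcompat, ← MonoidHom.comp_apply, D.prHat_comp]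
  have hker : ∀ g : W.hat, (g : W.Corhat) ∈ W.aug.ker ↔ eV g ∈ D.DeltaHat := by
    intro g
    have h1 : D.prHat (eV g) = σ (W.aug (g : W.Corhat)) := by
      change lhs g = rhs g
      rw [hagree]
    rw [MonoidHom.mem_ker, MonoidHom.mem_ker, h1]
    constructor
    · intro h; rw [h, map_one]
    · intro h; exact hσ (by rw [h, map_one])
  refine ⟨eV, he', ?_, hker⟩
  -- `Π_v ↦ ιX(Π^tp_X)`: `eV(emb(incl P)) = ιX(φ(P)) = ιX(Π^tp_X)`
  ext y
  constructor
  · rintro ⟨g, hg, rfl⟩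
    rw [SetLike.mem_coe, Subgroup.mem_subgroupOf] at hg
    obtain ⟨x, hx⟩ := hg
    have hgx : g = embHatV x := Subtype.ext (by rw [hembHatV]; exact hx.symm)
    refine ⟨φ x, ?_⟩
    change D.ιX (φ x) = eV g
    rw [hgx, he']
  · rintro ⟨z, rfl⟩
    refine ⟨embHatV (φ.symm z), ?_, ?_⟩
    · rw [SetLike.mem_coe, Subgroup.mem_subgroupOf, hembHatV]
      exact ⟨φ.symm z, rfl⟩
    · change eV (embHatV (φ.symm z)) = D.ιX z
      rw [he', ContinuousMulEquiv.apply_symm_apply]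

end Generic

/-! ## The instance: the tower of record `ofPiCHat` and the [IUTchI] §2 datum of `X̲̲_v` -/

variable {p : ℕ} [Fact p.Prime] {M : MuTwoSetting p} (e : M.CLevelData)
  {E : M.toThetaSetting.EtaleThetaData} {l : ℕ} (C : E.DoubleUnderline l) {N : ℕ+}
  (μ : M.toThetaSetting.CyclotomeMod l N) (hC : M.toThetaSetting.Compat) (hS : M.toThetaSetting.Sec2Hyps)
  (hl : l.Prime) (hp2 : p ≠ 2) (hpl : p ≠ l) (hζ : ∃ ζ : M.toThetaSetting.K, IsPrimitiveRoot ζ (4 * l))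
  {η : (C.thetaEnvData μ hC hS).PiYdd → MuN p N} (hη : η ∈ (C.thetaEnvData μ hC hS).thetaCocycles)
  (hZ : Thm16Sub.KerToZIsCompactlyGenerated M.toThetaSetting) (hN : (C.Huu.subgroupOf (M.GtpXu l)).Normal)
  {P : TopGroup.{0}} (T : TemperedCoverings (BadPlaceSetting.ofUnderline C μ hC hS hl hp2 hpl hζ hη) P)

/-- **B15b — [IUTchII] Def 2.3 (i) «`Π̂_v := (Π^tp_{X̲̲_v})^∧`»: the IDENTIFICATION `eV : Π̂_v ⥲ Π̂_{X̲̲_v}` between abc-iut-L6-t19's GENUINE `±`-tower of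
record `PlusMinusTower.ofPiCHat` (its `Π̂_v = cl toPiCHat(inclX Π^tp_{X̲̲_v})` in `Π_C`) and abc-iut-L5's GENUINE [IUTchI] §2 datum
`StableCurveTemperedData.ofSpecialFibre` OF THE CURVE `X̲̲_v` (abc-iut-L6-t7's `temperedCurveXuuOfLevelData`: `Π^tp := Π^tp_{X̲̲_v} = C.Huu`,
`Π̂ :=` its closure in `Π_X`, with the induced `GroupLevelData`), for ANY special-fibre data of `X̲̲_v` (binders `Sf, h36, Σ ⊆ Σ̂, Π_ℍ, cuspMeetsH`).**
`eV` is the uniqueness isomorphism of the profinite completion of `Π^tp_{X̲̲_v}` (both sides are one: p437138 / `isProfiniteCompletion_toHat`);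
`eV (emb (incl x)) = toHat (refIso x)`; `eV` carries `Π_v = (emb ∘ incl)(P)` onto `toHat(Π^tp_{X̲̲_v})` and `Δ̂_v = Π̂_v ∩ Ker(aug)` onto `Δ̂_{X̲̲_v}`
(augmentations matched by the identity of `G_K`).  PROVED via `exists_isoV_of_isProfiniteCompletion`.
HONEST LABEL: GENUINE on both sides modulo the binders named in the signature (L02 `hZ`, `hN`, `d`, the special-fibre DATA of `X̲̲_v`);
nothing of the series is asserted; no side taken on [IUTchIII] Cor 3.12. ([IUTchII] Def 2.3 (i), kurims p.67; [IUTchI] Def 3.1 (e) p.62)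
[claim: Mochizuki2012, status: disputed] -/
theorem exists_isoV_ofPiCHat_ofSpecialFibreXuu (d : M.toTemperedCurve.GroupLevelData)
    (Sf : SpecialFibreData ((C.temperedCurveXuuOfLevelData C.l_ne_zero d).toTemperedArithmeticGroup
      (C.groupLevelDataXuu C.l_ne_zero d)))
    (h36 : Sf.Gc.Prop36Hypotheses) (Sigma SigmaHat : Set ℕ) (hsub : Sigma ⊆ SigmaHat) (hne : Sigma.Nonempty)
    (hprime : ∀ q ∈ SigmaHat, q.Prime) (hp : p ∉ Sigma) (TpH : Subgroup Sf.chart.G)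
    (HatH : Subgroup (TemperedGraphGroupData.exists_completion_of_prop36 Sf.Gc h36 Sf.chart).choose)
    (hle : TpH.map (TemperedGraphGroupData.exists_completion_of_prop36 Sf.Gc h36 Sf.chart).choose_spec.choose.toMonoidHom ≤ HatH)
    (cuspMeetsH : {x : (C.temperedCurveXuuOfLevelData C.l_ne_zero d).Pt //
      (C.temperedCurveXuuOfLevelData C.l_ne_zero d).IsCusp x} → Prop) :
    ∃ eV : ↥(ofPiCHat e C μ hC hS hl hp2 hpl hζ hη hZ hN T).hat ≃ₜ*
        (StableCurveTemperedData.ofSpecialFibre (C.temperedCurveXuuOfLevelData C.l_ne_zero d)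
          (C.groupLevelDataXuu C.l_ne_zero d) Sf h36 Sigma SigmaHat hsub hne hprime hp TpH HatH hle cuspMeetsH).PiHat,
      (∀ x : P,
        eV ⟨(ofPiCHat e C μ hC hS hl hp2 hpl hζ hη hZ hN T).emb (T.incl x),
            (ofPiCHat e C μ hC hS hl hp2 hpl hζ hη hZ hN T).embP_le_hat ⟨x, rfl⟩⟩ =
          (StableCurveTemperedData.ofSpecialFibre (C.temperedCurveXuuOfLevelData C.l_ne_zero d)
            (C.groupLevelDataXuu C.l_ne_zero d) Sf h36 Sigma SigmaHat hsub hne hprime hp TpH HatH hle cuspMeetsH).ιX (T.refIso x)) ∧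
      ((ofPiCHat e C μ hC hS hl hp2 hpl hζ hη hZ hN T).piV.subgroupOf (ofPiCHat e C μ hC hS hl hp2 hpl hζ hη hZ hN T).hat).map
          eV.toMulEquiv.toMonoidHom =
        (StableCurveTemperedData.ofSpecialFibre (C.temperedCurveXuuOfLevelData C.l_ne_zero d)
          (C.groupLevelDataXuu C.l_ne_zero d) Sf h36 Sigma SigmaHat hsub hne hprime hp TpH HatH hle cuspMeetsH).ιX.range ∧
      (∀ g : ↥(ofPiCHat e C μ hC hS hl hp2 hpl hζ hη hZ hN T).hat,
        (g : (ofPiCHat e C μ hC hS hl hp2 hpl hζ hη hZ hN T).Corhat) ∈ (ofPiCHat e C μ hC hS hl hp2 hpl hζ hη hZ hN T).aug.ker ↔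
          eV g ∈ (StableCurveTemperedData.ofSpecialFibre (C.temperedCurveXuuOfLevelData C.l_ne_zero d)
            (C.groupLevelDataXuu C.l_ne_zero d) Sf h36 Sigma SigmaHat hsub hne hprime hp TpH HatH hle cuspMeetsH).DeltaHat) := by
  -- (a) tower side at level `Π_v`: `Π̂_v` is a profinite completion of `Π_v` through `emb ∘ incl` (p437138)
  obtain ⟨embHatV, hembHatV, hWc⟩ := exists_embHatV_ofPiCHat e C μ hC hS hl hp2 hpl hζ hη hZ hN T
  -- (d) `prHat` of the curve side is continuous (`augHat` is)
  have hpr : Continuous (StableCurveTemperedData.OfSpecialFibre.augHatGK (C.temperedCurveXuuOfLevelData C.l_ne_zero d)) :=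
    (C.temperedCurveXuuOfLevelData C.l_ne_zero d).augHat.continuous.subtype_mk _
  -- (d) `augGK (refIso x) = aug (emb (incl x))` in `G_K` (σ := id)
  have hcompat : ∀ x : P,
      (StableCurveTemperedData.ofSpecialFibre (C.temperedCurveXuuOfLevelData C.l_ne_zero d)
        (C.groupLevelDataXuu C.l_ne_zero d) Sf h36 Sigma SigmaHat hsub hne hprime hp TpH HatH hle cuspMeetsH).prTp (T.refIso x) =
      (MonoidHom.id _) ((ofPiCHat e C μ hC hS hl hp2 hpl hζ hη hZ hN T).aug
        ((ofPiCHat e C μ hC hS hl hp2 hpl hζ hη hZ hN T).emb (T.incl x))) := by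
    intro x
    apply Subtype.ext
    change M.aug (T.refIso x).1 =
      ((ofPiCHat e C μ hC hS hl hp2 hpl hζ hη hZ hN T).aug ((ofPiCHat e C μ hC hS hl hp2 hpl hζ hη hZ hN T).emb (T.incl x))).1
    -- `emb (incl x) = toPiCHat (inclX (plainIso (incl x)))` definitionally; `aug ∘ toPiCHat ∘ inclX = M.aug` (p430433)
    have h1 : ((ofPiCHat e C μ hC hS hl hp2 hpl hζ hη hZ hN T).aug
        ((ofPiCHat e C μ hC hS hl hp2 hpl hζ hη hZ hN T).emb (T.incl x))).1 = M.aug (T.plainIso (T.incl x)).1 :=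
      ofCoverModel_aug_ι_inclX e C μ hC hS hl hp2 hpl hζ hη e.toPiCHat e.isProfiniteCompletion_toPiCHat
        e.toPiCHat_injective e.piCData.aug.toMonoidHom (fun g => e.piCData_aug_apply g) e.piCData.range_aug hZ hN T
        (T.plainIso (T.incl x)).1
    rw [h1, T.plainIso_incl]
    rfl
  obtain ⟨eV, heV, hmap, hker⟩ := exists_isoV_of_isProfiniteCompletion (ofPiCHat e C μ hC hS hl hp2 hpl hζ hη hZ hN T)
    (StableCurveTemperedData.ofSpecialFibre (C.temperedCurveXuuOfLevelData C.l_ne_zero d)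
      (C.groupLevelDataXuu C.l_ne_zero d) Sf h36 Sigma SigmaHat hsub hne hprime hp TpH HatH hle cuspMeetsH)
    embHatV hembHatV hWc (C.temperedCurveXuuOfLevelData C.l_ne_zero d).toHat (fun _ => rfl)
    (C.isProfiniteCompletion_temperedCurveXuuOfLevelData_toHat C.l_ne_zero d) T.refIso
    (continuous_aug_hat_ofPiCHat e C μ hC hS hl hp2 hpl hζ hη hZ hN T) hpr (MonoidHom.id _) continuous_id
    Function.injective_id hcompat
  refine ⟨eV, fun x => ?_, hmap, hker⟩
  have h2 : embHatV x = ⟨(ofPiCHat e C μ hC hS hl hp2 hpl hζ hη hZ hN T).emb (T.incl x),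
      (ofPiCHat e C μ hC hS hl hp2 hpl hζ hη hZ hN T).embP_le_hat ⟨x, rfl⟩⟩ := Subtype.ext (hembHatV x)
  have h1 := heV x
  rw [h2] at h1
  exact h1

end PlusMinusTower

end Literature.IUT.HodgeArakelov

end
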